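import Summits.QuantumFields.YangMills.Theorems.BalabanUVNodesN21RegularityTransferJunction
import Literature.MathematicalPhysics.QuantumFieldTheory.Balaban1983to89.Node00.SmallFieldChiOfRecord
import Literature.MathematicalPhysics.QuantumFieldTheory.Balaban1983to89.Node00.Record13NumericsOfThm1CCMW

/-!
# NODE N09 AT THE STAGE-13 v1.7 `SepCoPH` RECORD — THE TWO RADII OF RECORD, FILE 3: the level-`k` (8)-MEMBERSHIP CLAUSE `hreg8` («the radius-`εbg` background of record of
# an `ε₀`-regular field is `εreg`-regular») FROM N07's THEOREM-1 SLOT AT OBJECTS + NODE 00's ₈a rows, for every record whose background radius is PRINT-ADMISSIBLE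
# (`B₃ε₀ ≤ εreg ≤ εbg ≤ a₀`) — dag-n21-c's δ-linear transfer `plaqSmall_Uk_of_thm1_objects` read at N09's letters

TRACK A (YM-PLAN §2d, node N09 of 28), seat `pub-ymgap-dag-n09-w1` (D-0149 width seat 1∕4, generation 2), FILE 3 (`--supports` K1⁷ stmt-QuantumFields-20542 as a helper).
Imports dag-n21-c's `BalabanUVNodesN21RegularityTransferJunction` (p454585; N07's slot `hT1` = n07-a's `B11Thm1CarrierT.objects_of_thm1Printed` body, ₈a's rows `hUk`),
node00-def's `Node00.SmallFieldChiOfRecord` (`domAltOfRecord`) and K0-numerics' `Node00.Record13NumericsOfThm1CCMW` (the V18 witness, for the located remark).  Independent of FILES 1–2 (composes with them at the consumer: FILE 1 §3∕§4 take `hreg8` as displayed input).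
[B11] = [Balaban1985Variational] (CMP 102), [I] = [Balaban1987RG1] (CMP 109).  THEOREMS ONLY (0 `def`, 0 `sorry`).

WHY.  FILES 1–2 move N09's [B11] inputs from the background radius `εbg` to the cut-off radius `εreg ≤ εbg` along ONE displayed clause
`hreg8 : ∀ k ≤ K, ∀ V ∈ domAltOfRecord ν K k, Uk F N K k εbg V ∈ bgReg F N K k ν.εreg` — [B11] Thm 1 (8)'s membership «the minimal orbit lies in `𝔘_k(B₃ε₁)`» read for the
background OF RECORD of an `ε₀`-regular field.  WHO SUPPLIES IT: for a background radius INSIDE print's regime (`εbg ≤ a₀`), dag-n21-c's junction already turns N07's Theorem-1 slot at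
objects + NODE 00's ₈a rows («the (0.21) problem over `bgReg(εbg)` is solvable and its solution of record lies in [B11] (2)'s space at `εbg`») into `|U_k^{(εbg)}(V)(∂p) − 1| < B₃δη_k²`
for `δ`-regular `V`; THIS FILE reads that at `δ := ν.ε₀` (the small-field domain's threshold) and `B₃ν.ε₀ ≤ ν.εreg`.  At the V18 witness (`εbg = 1 > a₀`) the hypothesis `εbg ≤ a₀` FAILS —
the located word of FILE 1 §5 stands (there `hreg8`, like `h11`, is outside print's regime); this file is the supplier road for every print-admissible re-keying (`εbg := εreg = a₀` included).
* ★ `hreg8_of_thm1Objects_of_ukRows` — `hreg8` at `(ν, εbg, K)` from: N07's slot `hT1` at every member `(K, k)`, `k ≤ K`; ₈a's rows `hUk` at radius `εbg`; the numerics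
  `0 < ν.ε₀ ≤ a₁`, `B₃·ν.ε₀ ≤ ν.εreg ≤ εbg ≤ a₀`.
* `ukExists_εbg_of_ukRows` — the solvability half of `h11` at `εbg` on the domains is ₈a's row G₈a-1 verbatim (the UNIQUENESS half over the plaquette class `bgReg` is NOT
  supplied by (6), which speaks of (2)-class minimisers — node00∕N07's divergence D-defB-1; displayed elsewhere, untouched here).
* A6 guard `hreg8_levelZero`: at the zero-step member `K = 0` (`B₃ = 7`) both slots are dag-n21-c's level-zero theorems, so `hreg8` holds outright there.
* LOCATED `not_εbg_le_a₀_theta13OfThm1CCMW`: at the V18 witness (`εbg = 1`, guard `217·a₀ ≤ 2`) the road's hypothesis `εbg ≤ a₀` fails — consistent with FILE 1 §5.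

HONEST FRAMING: count-neutral junction BY NAME; NOTHING of Bałaban's asserted — N07's Theorem-1 slot (levels `k ≥ 1` = Bałaban's theorem, proved nowhere in the tree) and ₈a's rows stay
DISPLAYED hypotheses; N09 NOT discharged; K0⁷ ∕ K1⁷ NOT closed; counts unmoved (typed 28∕28 · discharged 5∕27); one finite four-torus programme at fixed ε — R4 closes the conditional rung
`BalabanLadder.UV` only; the Yang–Mills mass gap (Clay) is NOT proved by any of this; nothing continuum ∕ ℝ⁴ ∕ OS.  THEOREMS ONLY, standard axioms.
-/

noncomputable section

namespace Summit.QuantumFields.YangMills.BalabanUVNodes.N09BackgroundRadiiReg8OfThm1Objects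

open Literature.MathematicalPhysics.QuantumFieldTheory.Balaban1983to89
open Literature.MathematicalPhysics.QuantumFieldTheory.Balaban1983to89.T4Continuum (T4Family)
open Literature.MathematicalPhysics.QuantumFieldTheory.Balaban1983to89.Node00
open Literature.MathematicalPhysics.QuantumFieldTheory.Balaban1983to89.B12GaugeOrbits021 (OrbitRel)
open Summit.QuantumFields.YangMills.Theorems.N21RegularityTransferJunction (plaqSmall_Uk_of_thm1_objects thm1_objects_levelZero' ukRows_levelZero)

variable {F : T4Family} {N : ℕ} [NeZero N]

/-- ★ **THE (8)-MEMBERSHIP CLAUSE `hreg8` FROM N07's THEOREM-1 SLOT AT OBJECTS + ₈a's ROWS**, for a print-admissible background radius: if at every member `(K, k)`, `k ≤ K`,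
[B11] Thm 1 holds at NODE 00's objects (`hT1`: (8) existence in `𝔘_k(B₃ε₁)`, (6) uniqueness in `𝔘_k(ε₀′)` for `B₃ε₁ ≤ ε₀′ ≤ a₀`) and ₈a's rows hold at radius `εbg` (`hUk`: for `δ`-regular
data with `B₃δ ≤ εbg` the problem over `bgReg(εbg)` is solvable and its solution of record lies in (2)'s space at `εbg`), and the numerics satisfy `0 < ν.ε₀ ≤ a₁`,
`B₃·ν.ε₀ ≤ ν.εreg ≤ εbg ≤ a₀`, then for every `V` of the small-field domain `domAltOfRecord ν K k` (`|V(∂p) − 1| < ν.ε₀`) the radius-`εbg` background of record is `ν.εreg`-regular: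
`Uk F N K k εbg V ∈ bgReg F N K k ν.εreg` (dag-n21-c's `plaqSmall_Uk_of_thm1_objects` at `δ := ν.ε₀`, then `B₃ν.ε₀·η_k² ≤ ν.εreg·η_k²`).  CONDITIONAL on the two displayed slots.
[cite: Balaban1985Variational, Thm 1 (6) and (8) p.279; Balaban1987RG1, (1.1)–(1.2) p.260 and p.259] -/
theorem hreg8_of_thm1Objects_of_ukRows (ν : Stage7Numerics) (εbg a₀ a₁ B₃ : ℝ) (K : ℕ)
    (hT1 : ∀ k, k ≤ K → ∀ ε₁ : ℝ, 0 < ε₁ → ε₁ ≤ a₁ → ∀ V : GaugeField (F.P K) k (SU N), PlaqSmall ε₁ V →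
      (∃ U : GaugeField (F.P K) 0 (SU N), IsBackground (avOfRecord F N K) {U | InUkClassB11 F N K k (B₃ * ε₁) U} k V U) ∧
      (∀ ε₀ : ℝ, B₃ * ε₁ ≤ ε₀ → ε₀ ≤ a₀ → ∀ U U' : GaugeField (F.P K) 0 (SU N),
          IsBackground (avOfRecord F N K) {U | InUkClassB11 F N K k (B₃ * ε₁) U} k V U →
          IsBackground (avOfRecord F N K) {U | InUkClassB11 F N K k ε₀ U} k V U' → InUkClassB11 F N K k ε₀ U ∧ OrbitRel k U U'))
    (hUk : ∀ k, k ≤ K → ∀ (V : GaugeField (F.P K) k (SU N)) (δ : ℝ), 0 < δ → δ ≤ a₁ → B₃ * δ ≤ εbg → PlaqSmall δ V →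
      UkExists F N K k εbg V ∧ InUkClassB11 F N K k εbg (Uk F N K k εbg V))
    (hε₀ : 0 < ν.ε₀) (hε₀a : ν.ε₀ ≤ a₁) (hB : B₃ * ν.ε₀ ≤ ν.εreg) (hle : ν.εreg ≤ εbg) (hhi : εbg ≤ a₀) :
    ∀ k, k ≤ K → ∀ V ∈ domAltOfRecord F N ν K k, Uk F N K k εbg V ∈ bgReg F N K k ν.εreg := by
  intro k hk V hV
  have hVs : PlaqSmall ν.ε₀ V := (mem_domAltOfRecord_iff F N ν K k V).1 hV
  have hsmall := plaqSmall_Uk_of_thm1_objects (hT1 k hk) (hUk k hk) hhi hε₀ hε₀a (hB.trans hle) hVs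
  rw [mem_bgReg_iff]
  exact fun p => (hsmall p).trans_le (mul_le_mul_of_nonneg_right hB (sq_nonneg _))

/-- **THE SOLVABILITY HALF OF `h11` AT `εbg` ON THE DOMAINS IS ₈a's ROW G₈a-1** (read at `δ := ν.ε₀`): `UkExists F N K k εbg V` for every `V ∈ domAltOfRecord ν K k`, `k ≤ K`, under `hUk`
and `0 < ν.ε₀ ≤ a₁`, `B₃ν.ε₀ ≤ εbg`.  (The uniqueness half `UniqueUkOrbit` over the PLAQUETTE class is not supplied by (6), which constrains (2)-class minimisers — divergence
D-defB-1, node00∕N07 lanes; untouched.) [cite: Balaban1985Variational, Thm 1 (8) p.279; Balaban1987RG1, (1.1)–(1.2) p.260] -/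
theorem ukExists_εbg_of_ukRows (ν : Stage7Numerics) (εbg a₁ B₃ : ℝ) (K : ℕ)
    (hUk : ∀ k, k ≤ K → ∀ (V : GaugeField (F.P K) k (SU N)) (δ : ℝ), 0 < δ → δ ≤ a₁ → B₃ * δ ≤ εbg → PlaqSmall δ V →
      UkExists F N K k εbg V ∧ InUkClassB11 F N K k εbg (Uk F N K k εbg V))
    (hε₀ : 0 < ν.ε₀) (hε₀a : ν.ε₀ ≤ a₁) (hB : B₃ * ν.ε₀ ≤ εbg) :
    ∀ k, k ≤ K → ∀ V ∈ domAltOfRecord F N ν K k, UkExists F N K k εbg V :=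
  fun k hk V hV => (hUk k hk V ν.ε₀ hε₀ hε₀a hB ((mem_domAltOfRecord_iff F N ν K k V).1 hV)).1


/-- **A6 GUARD — THE JUNCTION FIRES AT THE ZERO-STEP MEMBER** (`K = 0`, `B₃ = 7`): there N07's slot and ₈a's rows are THEOREMS at the trivial level (dag-n21-c's
`thm1_objects_levelZero'` ∕ `ukRows_levelZero`), so `hreg8` holds OUTRIGHT for every numerics with `0 < ν.ε₀ ≤ a₁`, `7·ν.ε₀ ≤ ν.εreg ≤ εbg ≤ a₀` — the hypothesis set of
`hreg8_of_thm1Objects_of_ukRows` is not an empty range.  Nothing about the levels `k ≥ 1`. [cite: Balaban1987RG1, (0.17) p.255 (bookkeeping)] -/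
theorem hreg8_levelZero (ν : Stage7Numerics) (εbg a₀ a₁ : ℝ) (hε₀ : 0 < ν.ε₀) (hε₀a : ν.ε₀ ≤ a₁) (hB : 7 * ν.ε₀ ≤ ν.εreg) (hle : ν.εreg ≤ εbg)
    (hhi : εbg ≤ a₀) : ∀ k, k ≤ 0 → ∀ V ∈ domAltOfRecord F N ν 0 k, Uk F N 0 k εbg V ∈ bgReg F N 0 k ν.εreg := by
  refine hreg8_of_thm1Objects_of_ukRows ν εbg a₀ a₁ 7 0 (fun k hk => ?_) (fun k hk => ?_) hε₀ hε₀a hB hle hhi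
  · obtain rfl : k = 0 := Nat.le_zero.1 hk
    exact thm1_objects_levelZero' 0 a₀ a₁
  · obtain rfl : k = 0 := Nat.le_zero.1 hk
    exact ukRows_levelZero 0 a₁ εbg


/-- **LOCATED: THE SUPPLIER ROAD DOES NOT FIRE AT THE V18 WITNESS** `θ₁₃ᶜᶜᴹᵂ(j; γ; ε₀, ε₂₉; B₃, B₃′, a₀, a₁)`: its background radius is `εbg = 1` (`rfl`) while n09-w2 g0's junk-witness guard
has `217·a₀ ≤ 2`, so the hypothesis `εbg ≤ a₀` of `hreg8_of_thm1Objects_of_ukRows` FAILS there (`1 ≤ a₀` is false) — the (8)-membership clause at radius `1`, like `h11` at `εbg = 1`, is outside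
[B11] Thm 1's regime `ε₀ ≤ a₀`; the one-token re-keying `εbg := a₀` restores `εbg ≤ a₀` with equality. [cite: Balaban1985Variational, Thm 1 p.279; Balaban1987RG1, (1.2) p.260 (bookkeeping)] -/
theorem not_εbg_le_a₀_theta13OfThm1CCMW (j : ℕ) (γ ε₀ ε₂₉ B₃ B₃' a₀ a₁ : ℝ) (ha : 217 * a₀ ≤ 2) :
    ¬ ((theta13OfThm1CCMW F N j γ ε₀ ε₂₉ B₃ B₃' a₀ a₁).εbg ≤ a₀) := by
  rw [show (theta13OfThm1CCMW F N j γ ε₀ ε₂₉ B₃ B₃' a₀ a₁).εbg = 1 from rfl]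
  intro h
  linarith

end Summit.QuantumFields.YangMills.BalabanUVNodes.N09BackgroundRadiiReg8OfThm1Objects

end
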